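import Literature.NumberTheory.GaloisRepresentations.CompletionCompositum
import Literature.NumberTheory.GaloisRepresentations.LocalWeilDatumRelative
import Literature.NumberTheory.NumberFields.CompletionLocalDegree
import HarnessLib

/-!
# The compositum model `K_v(E) ⊆ K̄_v` of the completions in a TOWER `K ⊆ E ⊆ E'`: the places match (`w' ∣ w`), the isomorphisms `K_v(E) ≅ E_w`,
# `K_v(E') ≅ E'_{w'}` intertwine the inclusions, and the relative norms correspond: `θ(N_{K_v(E')/K_v(E)} y) = N_{E'_{w'}/E_w}(θ' y)`

Topic `NumberTheory/GaloisRepresentations`; namespace `Literature.NumberTheory.GaloisRepresentations.SemiLocal`, continuing `CompletionCompositum.lean`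
(for ONE finite Galois `E/K` and a `K`-embedding `ιE : E → K̄`: a place `w ∣ v` and a `K_v`-isomorphism `θ : K_v(E) → E_w` over `E`,
`exists_place_algHom_compositum`, `bijective_algHom_compositum`; rigidity `place_eq_of_algHom`).  For a TOWER `K ⊆ E ⊆ E'` of finite Galois extensions of
`K` with COMPATIBLE embeddings `ιE' ∘ (E → E') = ιE` (so `K_v(E) ≤ K_v(E')` in `K̄_v`), and any such `θ` (for `E`, at `w`) and `θ'` (for `E'`, at `w'`):
* §1 `adjoin_range_le_of_tower` — `K_v(E) ≤ K_v(E')`;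
* §2 ★ `under_eq_of_algHom_tower` — **rigidity in a tower**: a `K_v`-algebra map `E_{w₁} → E'_{w'}` extending `E → E'` forces `w' ∣ w₁` (it is continuous; for
  `e ∈ 𝔭_{w₁}` not in the prime of `E` below `w'`, `eᵏ → 0` in `E_{w₁}` while `|eᵏ|_{w'} = 1`);
* §3 ★★ `under_eq_of_algHom_compositum` — **the places match**: `w' ∩ E = w`; ★★ `algHom_compositum_inclusion` — **the isomorphisms intertwine the
  inclusions**: `θ'(y) = ι_{w'/w}(θ y)` for `y ∈ K_v(E)`, `ι_{w'/w} : E_w → E'_{w'}` the tree's local map (`adicCompletionOfLiesOver`; both sides are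
  `K_v`-algebra maps out of `K_v(E) = K_v(ιE(E))` agreeing on `ιE(E)`, `IntermediateField.adjoin_algHom_ext`);
* §4 ★★★ **`algHom_compositum_norm`** — **the relative norms correspond**: `θ (N_{K_v(E')/K_v(E)} y) = N_{E'_{w'}/E_w}(θ' y)` for the `K_v(E)`-algebra
  structure `towerAlgebra` of `K_v(E')` (the tree's convention for towers inside `K̄_v`, `LocalWeilDatumRelative`) and the `E_w`-algebra structure
  `SemiLocal.algebraPlace` of `E'_{w'}` (Mathlib `Algebra.norm_eq_of_equiv_equiv`).
Use (cell `bsd-print-cf2`, brick §4(c)/(e), dictionary item D2 «local model»): Rubin's `U_∞ = lim← U(F_n)` has transition maps the semi-local norms, which are the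
products of the LOCAL norms `N_{(F_{n'})_{w'}/(F_n)_w}` (`NumberFields/SemilocalNormPlaces`, `EllipticUnits/SemilocalUnitTowerNormPlaces`); THIS file moves
those local norms to the compositum tower `K_v(F_n) ⊆ K̄_v`, where the cell's Lubin–Tate / Coleman theory (`RelNormCoherentUnits`, `principalCoherentFamilies`,
norms `@Algebra.norm _ _ _ _ (towerAlgebra _)`) lives.  Theorems only; no definition, no instance, no named fact, no `sorry`.

## References
* [CasselsFrohlichANT1967] J. W. S. Cassels, A. Fröhlich (eds.), *Algebraic Number Theory* (1967), Ch. II (Cassels) §10 Theorem, §11 (local norms in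
  `K ⊗ k_v`); Ch. VII (Tate) §1.1, Prop. 1.2.
* [NeukirchANT1999] J. Neukirch, *Algebraic Number Theory* (1999), Ch. II (8.1)–(8.4) (extensions of valuations = embeddings into `K̄_v`, in towers).
-/

noncomputable section

open NumberField IsDedekindDomain IntermediateField
open scoped Valued

namespace Literature.NumberTheory.GaloisRepresentations

namespace SemiLocal

open Literature.NumberTheory.Automorphic Literature.NumberTheory.NumberFields LocalWeilDatum

universe u

variable {K : Type u} [Field K] [NumberField K] {E : Type u} [Field E] [NumberField E] [Algebra K E]
  {E' : Type u} [Field E'] [NumberField E'] [Algebra K E'] [Algebra E E'] [IsScalarTower K E E']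
  {v : HeightOneSpectrum (𝓞 K)}

/-! ### §1. `K_v(E) ≤ K_v(E')` for compatible embeddings -/

variable (v) (ιE : E →ₐ[K] AlgebraicClosure K) (ιE' : E' →ₐ[K] AlgebraicClosure K) (hι : ∀ e : E, ιE' (algebraMap E E' e) = ιE e)

omit [NumberField E] [NumberField E'] [IsScalarTower K E E'] in
include hι in
/-- For compatible embeddings `ιE' ∘ (E → E') = ιE` the composita are nested: `K_v(E) ≤ K_v(E')`. [cite: CasselsFrohlichANT1967, Ch. II §10] -/
theorem adjoin_range_le_of_tower :
    IntermediateField.adjoin (v.adicCompletion K) (Set.range ((absClosureEmbedding K (v.adicCompletion K)).comp ιE)) ≤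
      IntermediateField.adjoin (v.adicCompletion K) (Set.range ((absClosureEmbedding K (v.adicCompletion K)).comp ιE')) := by
  rw [IntermediateField.adjoin_le_iff]
  rintro _ ⟨e, rfl⟩
  refine IntermediateField.subset_adjoin _ _ ⟨algebraMap E E' e, ?_⟩
  rw [AlgHom.comp_apply, AlgHom.comp_apply, hι]

/-! ### §2. Rigidity in a tower: a `K_v`-algebra map `E_{w₁} → E'_{w'}` over `E → E'` forces `w' ∣ w₁` -/

omit [IsScalarTower K E E'] in
/-- ★ **Rigidity of completions in a tower**: if a `K_v`-algebra homomorphism `Θ : E_{w₁} → E'_{w'}` extends the inclusion `E → E'`, then the place `w'` of `E'`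
lies above `w₁` (`w' ∩ 𝓞_E = w₁`).  (`Θ` is `K_v`-linear from a finite-dimensional space over the complete field `K_v`, hence continuous; for `e ∈ 𝔭_{w₁}`
outside the prime of `E` below `w'` the powers `eᵏ` tend to `0` in `E_{w₁}` but have absolute value `1` in `E'_{w'}`.)
[cite: CasselsFrohlichANT1967, Ch. II §10 Theorem] [cite: NeukirchANT1999, Ch. II (8.1)–(8.2)] -/
theorem under_eq_of_algHom_tower [IsGalois K E] {w₁ : Place K E v} {w' : Place K E' v}
    (Θ : ((w₁ : HeightOneSpectrum (𝓞 E)).adicCompletion E) →ₐ[v.adicCompletion K] ((w' : HeightOneSpectrum (𝓞 E')).adicCompletion E'))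
    (hΘ : ∀ e : E, Θ (e : (w₁ : HeightOneSpectrum (𝓞 E)).adicCompletion E) =
      ((algebraMap E E' e : E') : (w' : HeightOneSpectrum (𝓞 E')).adicCompletion E')) :
    (w' : HeightOneSpectrum (𝓞 E')).under (𝓞 E) = (w₁ : HeightOneSpectrum (𝓞 E)) := by
  by_contra hne
  -- an integer of `E` in `𝔭_{w₁}` but not in the prime below `w'`
  have hP : ¬ (w₁ : HeightOneSpectrum (𝓞 E)).asIdeal ≤ ((w' : HeightOneSpectrum (𝓞 E')).under (𝓞 E)).asIdeal := by
    intro hle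
    exact hne (HeightOneSpectrum.ext
      ((w₁ : HeightOneSpectrum (𝓞 E)).isMaximal.eq_of_le ((w' : HeightOneSpectrum (𝓞 E')).under (𝓞 E)).isPrime.ne_top hle)).symm
  obtain ⟨r, hr₁, hr₂⟩ := Set.not_subset.mp hP
  have hr₂' : algebraMap (𝓞 E) (𝓞 E') r ∉ (w' : HeightOneSpectrum (𝓞 E')).asIdeal := fun h =>
    hr₂ (by rw [SetLike.mem_coe, HeightOneSpectrum.under_asIdeal]; exact Ideal.mem_comap.mpr h)
  set e : E := algebraMap (𝓞 E) E r with he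
  have hee' : algebraMap E E' e = algebraMap (𝓞 E') E' (algebraMap (𝓞 E) (𝓞 E') r) := by
    rw [he, ← IsScalarTower.algebraMap_apply, ← IsScalarTower.algebraMap_apply]
  have hv₁ : Valued.v (e : (w₁ : HeightOneSpectrum (𝓞 E)).adicCompletion E) < 1 := by
    rw [HeightOneSpectrum.valuedAdicCompletion_eq_valuation', he, HeightOneSpectrum.valuation_of_algebraMap]
    exact ((w₁ : HeightOneSpectrum (𝓞 E)).intValuation_lt_one_iff_mem r).mpr hr₁
  have hv₂ : Valued.v ((algebraMap E E' e : E') : (w' : HeightOneSpectrum (𝓞 E')).adicCompletion E') = 1 := by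
    rw [HeightOneSpectrum.valuedAdicCompletion_eq_valuation', hee', HeightOneSpectrum.valuation_of_algebraMap]
    exact le_antisymm ((w' : HeightOneSpectrum (𝓞 E')).intValuation_le_one _)
      (not_lt.mp fun h => hr₂' (((w' : HeightOneSpectrum (𝓞 E')).intValuation_lt_one_iff_mem _).mp h))
  -- normed structures
  letI : NontriviallyNormedField (v.adicCompletion K) :=
    Valued.toNontriviallyNormedField (v.adicCompletion K) (WithZero (Multiplicative ℤ))
  letI h₁ : NormedField ((w₁ : HeightOneSpectrum (𝓞 E)).adicCompletion E) :=
    Valued.toNormedField ((w₁ : HeightOneSpectrum (𝓞 E)).adicCompletion E) (WithZero (Multiplicative ℤ))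
  letI h₂ : NormedField ((w' : HeightOneSpectrum (𝓞 E')).adicCompletion E') :=
    Valued.toNormedField ((w' : HeightOneSpectrum (𝓞 E')).adicCompletion E') (WithZero (Multiplicative ℤ))
  have hcont : Continuous Θ := by
    haveI := finiteDimensional_place (v := v) w₁
    haveI : ContinuousSMul (v.adicCompletion K) ((w₁ : HeightOneSpectrum (𝓞 E)).adicCompletion E) :=
      continuousSMul_of_algebraMap _ _ (continuous_adicCompletionOfLiesOver K E v (w₁ : HeightOneSpectrum (𝓞 E)))
    haveI : ContinuousSMul (v.adicCompletion K) ((w' : HeightOneSpectrum (𝓞 E')).adicCompletion E') :=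
      continuousSMul_of_algebraMap _ _ (continuous_adicCompletionOfLiesOver K E' v (w' : HeightOneSpectrum (𝓞 E')))
    exact LinearMap.continuous_of_finiteDimensional Θ.toLinearMap
  -- `eᵏ → 0` in `E_{w₁}`, so `Θ(eᵏ) = (e)ᵏ → 0` in `E'_{w'}`
  have hlim₁ : Filter.Tendsto (fun k : ℕ => (e : (w₁ : HeightOneSpectrum (𝓞 E)).adicCompletion E) ^ k) Filter.atTop (nhds 0) :=
    tendsto_pow_atTop_nhds_zero_of_norm_lt_one ((Valued.toNormedField.norm_lt_one_iff).mpr hv₁)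
  have hlim₂ : Filter.Tendsto (fun k : ℕ => ((algebraMap E E' e : E') : (w' : HeightOneSpectrum (𝓞 E')).adicCompletion E') ^ k)
      Filter.atTop (nhds 0) := by
    have := (hcont.tendsto 0).comp hlim₁
    rw [map_zero] at this
    refine this.congr fun k => ?_
    simp only [Function.comp_apply, map_pow, hΘ]
  -- but `‖(e)ᵏ‖ = 1` in `E'_{w'}`
  have hnorm : ∀ k : ℕ, ‖((algebraMap E E' e : E') : (w' : HeightOneSpectrum (𝓞 E')).adicCompletion E') ^ k‖ = 1 := fun k => by
    have h1 : ‖((algebraMap E E' e : E') : (w' : HeightOneSpectrum (𝓞 E')).adicCompletion E')‖ = 1 :=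
      le_antisymm (Valued.toNormedField.norm_le_one_iff.mpr hv₂.le) (Valued.toNormedField.one_le_norm_iff.mpr hv₂.ge)
    rw [norm_pow, h1, one_pow]
  have h0 : ‖(0 : (w' : HeightOneSpectrum (𝓞 E')).adicCompletion E')‖ = 1 := by
    have hc := (continuous_norm.tendsto _).comp hlim₂
    have hconst : (fun k : ℕ => ‖((algebraMap E E' e : E') : (w' : HeightOneSpectrum (𝓞 E')).adicCompletion E') ^ k‖) = fun _ => (1 : ℝ) :=
      funext hnorm
    rw [show ((fun x => ‖x‖) ∘ fun k : ℕ => ((algebraMap E E' e : E') : (w' : HeightOneSpectrum (𝓞 E')).adicCompletion E') ^ k) =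
        fun _ => (1 : ℝ) from hconst] at hc
    exact tendsto_nhds_unique hc tendsto_const_nhds
  rw [norm_zero] at h0
  exact zero_ne_one h0

/-! ### §3. The compositum isomorphisms of a tower: matching places and intertwining the inclusions -/

section Compositum

variable [IsGalois K E] [IsGalois K E'] {w : Place K E v} {w' : Place K E' v}
  (θ : IntermediateField.adjoin (v.adicCompletion K) (Set.range ((absClosureEmbedding K (v.adicCompletion K)).comp ιE)) →ₐ[v.adicCompletion K]
    (w : HeightOneSpectrum (𝓞 E)).adicCompletion E)
  (hθ : ∀ e : E, θ ⟨(absClosureEmbedding K (v.adicCompletion K)).comp ιE e, mem_compositum v ιE e⟩ = algebraMap E _ e)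
  (θ' : IntermediateField.adjoin (v.adicCompletion K) (Set.range ((absClosureEmbedding K (v.adicCompletion K)).comp ιE')) →ₐ[v.adicCompletion K]
    (w' : HeightOneSpectrum (𝓞 E')).adicCompletion E')
  (hθ' : ∀ e' : E', θ' ⟨(absClosureEmbedding K (v.adicCompletion K)).comp ιE' e', mem_compositum v ιE' e'⟩ = algebraMap E' _ e')

omit [IsScalarTower K E E'] [IsGalois K E'] in
include hι hθ hθ' in
/-- ★★ **The places match**: for compositum isomorphisms `θ : K_v(E) ≅ E_w`, `θ' : K_v(E') ≅ E'_{w'}` over `E`, `E'` (compatible embeddings), the place `w'`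
lies above `w` — apply §2 to `θ' ∘ (K_v(E) ≤ K_v(E')) ∘ θ⁻¹ : E_w → E'_{w'}`. [cite: CasselsFrohlichANT1967, Ch. II §10 Theorem; Ch. VII §1.1] -/
theorem under_eq_of_algHom_compositum : (w' : HeightOneSpectrum (𝓞 E')).under (𝓞 E) = (w : HeightOneSpectrum (𝓞 E)) := by
  let θe := AlgEquiv.ofBijective θ (bijective_algHom_compositum v ιE θ hθ)
  let Θ : ((w : HeightOneSpectrum (𝓞 E)).adicCompletion E) →ₐ[v.adicCompletion K] ((w' : HeightOneSpectrum (𝓞 E')).adicCompletion E') :=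
    (θ'.comp (IntermediateField.inclusion (adjoin_range_le_of_tower v ιE ιE' hι))).comp (θe.symm : _ →ₐ[v.adicCompletion K] _)
  refine under_eq_of_algHom_tower v Θ fun e => ?_
  have hsymm : θe.symm (e : (w : HeightOneSpectrum (𝓞 E)).adicCompletion E) =
      ⟨(absClosureEmbedding K (v.adicCompletion K)).comp ιE e, mem_compositum v ιE e⟩ := by
    rw [AlgEquiv.symm_apply_eq]
    exact (hθ e).symm
  have hincl : IntermediateField.inclusion (adjoin_range_le_of_tower v ιE ιE' hι)
        ⟨(absClosureEmbedding K (v.adicCompletion K)).comp ιE e, mem_compositum v ιE e⟩ =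
      ⟨(absClosureEmbedding K (v.adicCompletion K)).comp ιE' (algebraMap E E' e), mem_compositum v ιE' (algebraMap E E' e)⟩ :=
    Subtype.ext (show (absClosureEmbedding K (v.adicCompletion K)).comp ιE e =
      (absClosureEmbedding K (v.adicCompletion K)).comp ιE' (algebraMap E E' e) by rw [AlgHom.comp_apply, AlgHom.comp_apply, hι])
  show θ' (IntermediateField.inclusion (adjoin_range_le_of_tower v ιE ιE' hι) (θe.symm (e : (w : HeightOneSpectrum (𝓞 E)).adicCompletion E))) = _
  rw [hsymm, hincl, hθ']
  rfl

omit [IsGalois K E] [IsGalois K E'] in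
include hι hθ hθ' in
/-- ★★ **The isomorphisms intertwine the inclusions**: `θ'(y) = ι_{w'/w}(θ y)` for `y ∈ K_v(E) ≤ K_v(E')`, with `ι_{w'/w} : E_w → E'_{w'}` the tree's local map
(`adicCompletionOfLiesOver`; the `LiesOver` witness, e.g. from `under_eq_of_algHom_compositum`, is an argument).  Both sides are `K_v`-algebra maps out of
`K_v(E) = K_v(ιE(E))` (`ι_{w'/w}` is `K_v`-linear by the tower law `adicCompletionOfLiesOver_comp`) and agree on `ιE(E)`.
[cite: CasselsFrohlichANT1967, Ch. II §10 Theorem, §11] [cite: NeukirchANT1999, Ch. II (8.2)] -/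
theorem algHom_compositum_inclusion [(w' : HeightOneSpectrum (𝓞 E')).asIdeal.LiesOver (w : HeightOneSpectrum (𝓞 E)).asIdeal]
    (y : IntermediateField.adjoin (v.adicCompletion K) (Set.range ((absClosureEmbedding K (v.adicCompletion K)).comp ιE))) :
    θ' (IntermediateField.inclusion (adjoin_range_le_of_tower v ιE ιE' hι) y) =
      adicCompletionOfLiesOver E E' (w : HeightOneSpectrum (𝓞 E)) (w' : HeightOneSpectrum (𝓞 E')) (θ y) := by
  -- `w'` as a place of `E'` above `w`, and the tower law `K_v → E_w → E'_{w'}`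
  let w'e : Place E E' (w : HeightOneSpectrum (𝓞 E)) :=
    ⟨(w' : HeightOneSpectrum (𝓞 E')), HeightOneSpectrum.ext (Ideal.LiesOver.over (p := (w : HeightOneSpectrum (𝓞 E)).asIdeal)
      (P := (w' : HeightOneSpectrum (𝓞 E')).asIdeal)).symm⟩
  haveI : ((w'e : HeightOneSpectrum (𝓞 E'))).asIdeal.LiesOver v.asIdeal := Place.liesOver w'
  have hcomp := adicCompletionOfLiesOver_comp (K := K) (F := E) (E := E') (v₀ := v) w w'e
  -- `ι_{w'/w}` as a `K_v`-algebra map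
  let ιw : ((w : HeightOneSpectrum (𝓞 E)).adicCompletion E) →ₐ[v.adicCompletion K] ((w' : HeightOneSpectrum (𝓞 E')).adicCompletion E') :=
    { adicCompletionOfLiesOver E E' (w : HeightOneSpectrum (𝓞 E)) (w' : HeightOneSpectrum (𝓞 E')) with
      commutes' := fun c => by
        show adicCompletionOfLiesOver E E' (w : HeightOneSpectrum (𝓞 E)) (w'e : HeightOneSpectrum (𝓞 E'))
            (adicCompletionOfLiesOver K E v (w : HeightOneSpectrum (𝓞 E)) c) =
          adicCompletionOfLiesOver K E' v (w'e : HeightOneSpectrum (𝓞 E')) c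
        exact congrArg (fun g => g c) hcomp }
  have key : θ'.comp (IntermediateField.inclusion (adjoin_range_le_of_tower v ιE ιE' hι)) = ιw.comp θ := by
    refine IntermediateField.adjoin_algHom_ext (v.adicCompletion K) fun x hx => ?_
    obtain ⟨e, rfl⟩ := hx
    have hincl : IntermediateField.inclusion (adjoin_range_le_of_tower v ιE ιE' hι)
          ⟨(absClosureEmbedding K (v.adicCompletion K)).comp ιE e, IntermediateField.subset_adjoin _ _ ⟨e, rfl⟩⟩ =
        ⟨(absClosureEmbedding K (v.adicCompletion K)).comp ιE' (algebraMap E E' e), mem_compositum v ιE' (algebraMap E E' e)⟩ :=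
      Subtype.ext (show (absClosureEmbedding K (v.adicCompletion K)).comp ιE e =
        (absClosureEmbedding K (v.adicCompletion K)).comp ιE' (algebraMap E E' e) by rw [AlgHom.comp_apply, AlgHom.comp_apply, hι])
    have h1 : θ' (IntermediateField.inclusion (adjoin_range_le_of_tower v ιE ιE' hι)
          ⟨(absClosureEmbedding K (v.adicCompletion K)).comp ιE e, IntermediateField.subset_adjoin _ _ ⟨e, rfl⟩⟩) =
        ((algebraMap E E' e : E') : (w' : HeightOneSpectrum (𝓞 E')).adicCompletion E') := by
      rw [hincl, hθ']
      rfl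
    have h2 : ιw (θ ⟨(absClosureEmbedding K (v.adicCompletion K)).comp ιE e, IntermediateField.subset_adjoin _ _ ⟨e, rfl⟩⟩) =
        ((algebraMap E E' e : E') : (w' : HeightOneSpectrum (𝓞 E')).adicCompletion E') := by
      show adicCompletionOfLiesOver E E' (w : HeightOneSpectrum (𝓞 E)) (w' : HeightOneSpectrum (𝓞 E'))
          (θ ⟨(absClosureEmbedding K (v.adicCompletion K)).comp ιE e, mem_compositum v ιE e⟩) = _
      rw [hθ e]
      exact adicCompletionOfLiesOver_coe E E' (w : HeightOneSpectrum (𝓞 E)) (w' : HeightOneSpectrum (𝓞 E')) e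
    exact h1.trans h2.symm
  exact congrArg (fun f : _ →ₐ[v.adicCompletion K] _ => f y) key

/-! ### §4. The relative norms correspond: `θ(N_{K_v(E')/K_v(E)} y) = N_{E'_{w'}/E_w}(θ' y)` -/

include hι hθ hθ' in
/-- ★★★ **THE COMPOSITUM ISOMORPHISMS CARRY THE RELATIVE NORM OF `K_v(E')/K_v(E)` TO THE LOCAL NORM `N_{E'_{w'}/E_w}`**: for the `K_v(E)`-algebra structure
`towerAlgebra` of `K_v(E')` (the cell's convention for towers inside `K̄_v`) and the `E_w`-algebra structure `algebraPlace` of `E'_{w'}` (`w'` viewed as a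
place of `E'` above `w`, `under_eq_of_algHom_compositum`), `θ (N_{K_v(E')/K_v(E)} y) = N_{E'_{w'}/E_w}(θ' y)` for every `y ∈ K_v(E')`
(Mathlib `Algebra.norm_eq_of_equiv_equiv` along the pair of ring isomorphisms `θ`, `θ'`, which intertwine the structure maps by §3).
[cite: CasselsFrohlichANT1967, Ch. II §11] [cite: NeukirchANT1999, Ch. II (8.4)] -/
theorem algHom_compositum_norm
    (y : IntermediateField.adjoin (v.adicCompletion K) (Set.range ((absClosureEmbedding K (v.adicCompletion K)).comp ιE'))) :
    θ (@Algebra.norm _ _ _ _ (towerAlgebra (adjoin_range_le_of_tower v ιE ιE' hι)) y) =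
      @Algebra.norm ((w : HeightOneSpectrum (𝓞 E)).adicCompletion E) ((w' : HeightOneSpectrum (𝓞 E')).adicCompletion E') _ _
        (SemiLocal.algebraPlace (F := E) (E := E') (v := (w : HeightOneSpectrum (𝓞 E)))
          ⟨(w' : HeightOneSpectrum (𝓞 E')), under_eq_of_algHom_compositum v ιE ιE' hι θ hθ θ' hθ'⟩)
        (θ' y) := by
  letI := towerAlgebra (adjoin_range_le_of_tower v ιE ιE' hι)
  let w'e : Place E E' (w : HeightOneSpectrum (𝓞 E)) := ⟨(w' : HeightOneSpectrum (𝓞 E')), under_eq_of_algHom_compositum v ιE ιE' hι θ hθ θ' hθ'⟩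
  letI : Algebra ((w : HeightOneSpectrum (𝓞 E)).adicCompletion E) ((w' : HeightOneSpectrum (𝓞 E')).adicCompletion E') := SemiLocal.algebraPlace w'e
  haveI : (w' : HeightOneSpectrum (𝓞 E')).asIdeal.LiesOver (w : HeightOneSpectrum (𝓞 E)).asIdeal := Place.liesOver w'e
  let e₁ := RingEquiv.ofBijective θ.toRingHom (bijective_algHom_compositum v ιE θ hθ)
  let e₂ := RingEquiv.ofBijective θ'.toRingHom (bijective_algHom_compositum v ιE' θ' hθ')
  have he : RingHom.comp (algebraMap ((w : HeightOneSpectrum (𝓞 E)).adicCompletion E) ((w' : HeightOneSpectrum (𝓞 E')).adicCompletion E'))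
      (e₁ : IntermediateField.adjoin (v.adicCompletion K) (Set.range ((absClosureEmbedding K (v.adicCompletion K)).comp ιE)) →+*
        (w : HeightOneSpectrum (𝓞 E)).adicCompletion E) =
      RingHom.comp (e₂ : IntermediateField.adjoin (v.adicCompletion K) (Set.range ((absClosureEmbedding K (v.adicCompletion K)).comp ιE')) →+*
        (w' : HeightOneSpectrum (𝓞 E')).adicCompletion E')
      (algebraMap (IntermediateField.adjoin (v.adicCompletion K) (Set.range ((absClosureEmbedding K (v.adicCompletion K)).comp ιE)))
        (IntermediateField.adjoin (v.adicCompletion K) (Set.range ((absClosureEmbedding K (v.adicCompletion K)).comp ιE')))) := by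
    refine RingHom.ext fun x => ?_
    show adicCompletionOfLiesOver E E' (w : HeightOneSpectrum (𝓞 E)) (w'e : HeightOneSpectrum (𝓞 E')) (θ x) =
      θ' (IntermediateField.inclusion (adjoin_range_le_of_tower v ιE ιE' hι) x)
    exact (algHom_compositum_inclusion v ιE ιE' hι θ hθ θ' hθ' x).symm
  have h := Algebra.norm_eq_of_equiv_equiv e₁ e₂ he y
  -- `h : N_{K_v(E')/K_v(E)} y = e₁.symm (N_{E'_{w'}/E_w} (e₂ y))`
  rw [h]
  show θ (e₁.symm _) = _
  exact e₁.apply_symm_apply _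

end Compositum

end SemiLocal

end Literature.NumberTheory.GaloisRepresentations

end
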